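import Summits.QuantumFields.BalabanUV.T4Continuum.Support.NE7StraightSliceB5ChartCurl
import Summits.QuantumFields.BalabanUV.T4Continuum.Support.NE7FlatSliceSourceDuality
import Summits.QuantumFields.BalabanUV.T4Continuum.Support.NE7ApeFlatSkeleton
import Summits.QuantumFields.BalabanUV.T4Continuum.Support.NE3LatticeWeitzenbock
import HarnessLib

/-!
# NE7StraightSliceB5ChartForms — row NE7 (node U5), the (A)-bill's XL(c) docking, file D5 (iii) of `t4/b2b-balaban-t4-ne7-p2/g84/XLC-DOCKING-MEMO.md` §7 (second half):
# THE TWO PAIRINGS OF (142)'s RANK-ONE LETTER IN lit-balaban's SYMBOLS — the flat Hessian `hess 1 ξ ζ (perWin)` is `½ Re ⟨toB5 ζ, ∂ᴴ∂ (toB5 ξ)⟩`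
# (`∂ = B5Action121.CurlOp` at lattice factor `c = 1`), and the source pairing `srcPair h ζ (periodBox)` is `Re ⟨toB5 h, toB5 ζ⟩`

Lineage `b2b-balaban-t4-ne7-p2` (CRUX PROVER NE7 #2, co-owner of row NE7), generation 84 (staged behind (143)∕(144)∕(137)'s oleans).  Over (143) `NE7StraightSliceB5Chart` (chart, transfer),
(144) `NE7StraightSliceB5ChartCurl` (`CurlOp_mulVec_toB5`, `sum_tor_liftT`), (137) `NE7FlatSliceSourceDuality.srcPair`, `NE7ApeFlatSkeleton.hess_flat`, `NE3CovariantCalculus.hsR`,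
lit-balaban's `B5Action121` (`CurlOp`, `star_mulVec_dotProduct`), `NE3LatticeWeitzenbock.sum_sum_eq_two_mul_sum_plane`.
WHAT ([folklore]).  §1 rank-one readings: `nReTr M = Re M₀₀`, `hsR A B = Re(conj A₀₀ · B₀₀)`; for SKEW rank-one fields `conj (curl ζ)₀₀ = −(curl ζ)₀₀`.  §2 **`hess_flat_rankOne_eq`**:
`hess 1 ξ ζ (perWin d P) = −Σ_{x∈periodBox P} Σ_{planes μ<ν} Re((curlAt 1 ζ x μ ν)₀₀ · (curlAt 1 ξ x μ ν)₀₀)`; **`hess_flat_eq_re_form_CurlOp`**: for skew `P`-periodic rank-one `ξ, ζ`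
(`P ≥ 2`), `hess 1 ξ ζ (perWin d P) = ½ · Re (star (toB5 ζ) ⬝ᵥ ((CurlOp 1)ᴴ * CurlOp 1 *ᵥ toB5 ξ))` — the first term of lit-balaban's `B5DeltaA169.DeltaA_eq_curl` at `c = 1`
(the lattice factor `c = n = η⁻¹` of `DeltaA` multiplies this by `n²`).  §3 **`srcPair_eq_re_dotProduct`**: `srcPair h ζ (periodBox P) = Re (star (toB5 h) ⬝ᵥ toB5 ζ)`.
So all four objects of (142)'s letter `h1src` (constraint 143, curl∕norms 144, Hessian and source pairing here) are lit-balaban objects on `Tor (P,…,P) × Fin d → ℂ`.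
HONEST FRAMING (page 1): [folklore] index bookkeeping; NO estimate; nothing of Bałaban's asserted beyond lit-balaban's typed (1.2)∕(1.21); NOT (APE), NOT ONE-STEP, NOT NE7; spine 0∕9;
finite T⁴ rung (B)+1 — NOT infinite volume, NOT mass gap, NOT Clay.  Continuum YM on T⁴ ⇐ BetaPertH ∧ nine spine estimates (0/9 proved); BetaPertH ⇐ (D1) ∧ (D4) ∧ CAP+tail;
G-an2-4 gates asym, D1 and NE2/3/4.
-/

set_option autoImplicit false

open scoped BigOperators Matrix Matrix.Norms.L2Operator ComplexConjugate
open Finset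

namespace Summit.QuantumFields.BalabanUV.T4Continuum.NE7StraightSliceB5ChartForms

open Literature.MathematicalPhysics.QuantumFieldTheory.Balaban1983to89
open B7Prop1Explicit UnitaryModel
open B5Prop11Plancherel (Tor)
open B5Action121 (CurlOp star_mulVec_dotProduct)
open T4AveragingDeficitWall (curlAt curl IsSkewDir flat_mem_classes)
open T4AveragingDeficitWallBoundary (periodBox)
open AveragingDeficitPeriodicCounting (IsPeriodicDir)
open MinimalActionLevels (perWin)
open BlockAveragePushDirSplit (flat)
open NE3HessForm (hess)
open NE3SmoothLiftCurl (curlAt_flat_eq)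
open NE3CovariantCalculus (hsR)
open NE3LatticeWeitzenbock (sum_sum_eq_two_mul_sum_plane)
open NE7FlatSliceSourceDuality (srcPair)
open NE7StraightSliceB5Chart (liftT toB5 toB5_apply)
open NE7StraightSliceB5ChartCurl (CurlOp_mulVec_toB5 sum_tor_liftT)

noncomputable section

variable {d : ℕ}

local notation "𝕄₁" => Matrix (Fin 1) (Fin 1) ℂ

/-! ## §1 Rank-one readings of the tree's trace functionals -/

/-- `Re tr M ∕ 1 = Re M₀₀` on `M₁(ℂ)`. [folklore] -/
theorem nReTr_fin_one (M : 𝕄₁) : nReTr M = (M 0 0).re := by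
  unfold UnitaryModel.nReTr
  rw [Matrix.trace_fin_one, Fintype.card_fin, Nat.cast_one, div_one]

/-- `hsR A B = Re(conj A₀₀ · B₀₀)` on `M₁(ℂ)`. [folklore] -/
theorem hsR_fin_one (A B : 𝕄₁) : hsR A B = (conj (A 0 0) * B 0 0).re := by
  unfold NE3CovariantCalculus.hsR
  rw [nReTr_fin_one, Matrix.mul_apply, Fin.sum_univ_one, Matrix.conjTranspose_apply, Complex.star_def]

/-- A product of `1×1` matrices, read at the entry. [folklore] -/
theorem mul_fin_one_apply (A B : 𝕄₁) : (A * B) 0 0 = A 0 0 * B 0 0 := by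
  rw [Matrix.mul_apply, Fin.sum_univ_one]

/-- A skew rank-one field has purely imaginary entries: `conj (ζ y κ)₀₀ = −(ζ y κ)₀₀`. [folklore] -/
theorem conj_entry_of_skew {ζ : Site d → Fin d → 𝕄₁} (hζ : IsSkewDir ζ) (y : Site d) (κ : Fin d) : conj (ζ y κ 0 0) = -ζ y κ 0 0 := by
  have h00 : (star (ζ y κ)) 0 0 = (-(ζ y κ)) 0 0 := by rw [skewAdjoint.mem_iff.mp (hζ y κ)]
  rwa [Matrix.star_apply, Matrix.neg_apply, Complex.star_def] at h00

/-- The flat curl of a skew rank-one field has purely imaginary entry: `conj (curl 1 ζ)₀₀ = −(curl 1 ζ)₀₀`. [folklore] -/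
theorem conj_curlAt_flat_of_skew {ζ : Site d → Fin d → 𝕄₁} (hζ : IsSkewDir ζ) (x : Site d) (μ ν : Fin d) :
    conj ((curlAt (flat (d := d) (n := Fin 1)) ζ x μ ν) 0 0) = -(curlAt (flat (d := d) (n := Fin 1)) ζ x μ ν) 0 0 := by
  rw [curlAt_flat_eq]
  simp only [Matrix.sub_apply, map_sub, conj_entry_of_skew hζ]
  ring

/-! ## §2 The flat Hessian at rank one: plaquette sum of entries, and lit-balaban's `∂ᴴ∂` form -/

/-- **THE FLAT HESSIAN AT RANK ONE**: `hess 1 ξ ζ (perWin d P) = −Σ_{x∈periodBox P} Σ_{planes} Re((curl 1 ζ)₀₀ · (curl 1 ξ)₀₀)`. [folklore] -/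
theorem hess_flat_rankOne_eq (ξ ζ : Site d → Fin d → 𝕄₁) (P : ℕ) :
    hess (flat (d := d) (n := Fin 1)) ξ ζ (perWin d P)
      = -∑ x ∈ periodBox (d := d) P, ∑ π : T4AveragingDeficitWall.Plane d,
          ((curlAt (flat (d := d) (n := Fin 1)) ζ x π.1.1 π.1.2) 0 0 * (curlAt (flat (d := d) (n := Fin 1)) ξ x π.1.1 π.1.2) 0 0).re := by
  rw [NE7ApeFlatSkeleton.hess_flat (flat_mem_classes (d := d) (n := Fin 1) le_rfl).2]
  unfold MinimalActionLevels.perWin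
  rw [Finset.sum_product]
  congr 1
  refine Finset.sum_congr rfl fun x _ => Finset.sum_congr rfl fun π _ => ?_
  rw [nReTr_fin_one, curl, curl, mul_fin_one_apply]

/-- **THE FLAT HESSIAN IS HALF THE REAL PART OF lit-balaban's `∂ᴴ∂` FORM** (ordered pairs count every plane twice; skewness turns `conj F·F′` into `−F·F′`):
for skew `P`-periodic rank-one `ξ, ζ` (`P ≥ 2`), `hess 1 ξ ζ (perWin d P) = ½ · Re (star (toB5 ζ) ⬝ᵥ (((CurlOp 1)ᴴ * CurlOp 1) *ᵥ toB5 ξ))`.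
[cite: Balaban1984PropagatorsI, (1.2) p.18, (1.21) p.21] -/
theorem hess_flat_eq_re_form_CurlOp (P : ℕ) [NeZero P] (hP : 2 ≤ P) {ξ ζ : Site d → Fin d → 𝕄₁}
    (hξP : IsPeriodicDir ξ (P : ℤ)) (hζs : IsSkewDir ζ) (hζP : IsPeriodicDir ζ (P : ℤ)) :
    hess (flat (d := d) (n := Fin 1)) ξ ζ (perWin d P)
      = (1 / 2 : ℝ) * (star (toB5 (N := fun _ : Fin d => P) ζ)
          ⬝ᵥ ((((CurlOp (fun _ : Fin d => P) 1)ᴴ * CurlOp (fun _ : Fin d => P) 1) *ᵥ toB5 ξ))).re := by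
  rw [← Matrix.mulVec_mulVec, ← star_mulVec_dotProduct]
  -- the B5 form as a sum over the torus, ordered pairs
  rw [dotProduct, Fintype.sum_prod_type, Complex.re_sum]
  simp_rw [Fintype.sum_prod_type, Complex.re_sum, Pi.star_apply, CurlOp_mulVec_toB5 hP 1 hξP, CurlOp_mulVec_toB5 hP 1 hζP, one_mul,
    Complex.star_def, conj_curlAt_flat_of_skew hζs]
  rw [sum_tor_liftT P (fun y => ∑ μ : Fin d, ∑ ν : Fin d,
    (-(curlAt (flat (d := d) (n := Fin 1)) ζ y μ ν) 0 0 * (curlAt (flat (d := d) (n := Fin 1)) ξ y μ ν) 0 0).re), hess_flat_rankOne_eq, Finset.mul_sum,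
    ← Finset.sum_neg_distrib]
  refine Finset.sum_congr rfl fun x _ => ?_
  -- ordered pairs = twice the planes (the summand is symmetric in `μ ν` and vanishes on the diagonal)
  have hanti : ∀ (Y : Site d → Fin d → 𝕄₁) (μ ν : Fin d),
      (curlAt (flat (d := d) (n := Fin 1)) Y x ν μ) 0 0 = -(curlAt (flat (d := d) (n := Fin 1)) Y x μ ν) 0 0 := fun Y μ ν => by
    rw [curlAt_flat_eq, curlAt_flat_eq]; simp only [Matrix.sub_apply]; ring
  rw [sum_sum_eq_two_mul_sum_plane (fun μ ν => (-(curlAt (flat (d := d) (n := Fin 1)) ζ x μ ν) 0 0 * (curlAt (flat (d := d) (n := Fin 1)) ξ x μ ν) 0 0).re)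
    (fun μ => by rw [curlAt_flat_eq]; simp) (fun μ ν => by rw [hanti ζ μ ν, hanti ξ μ ν]; ring_nf)]
  rw [Finset.mul_sum, Finset.mul_sum, ← Finset.sum_neg_distrib]
  refine Finset.sum_congr rfl fun π _ => ?_
  rw [neg_mul, Complex.neg_re]
  ring

/-! ## §3 The source pairing is the real part of lit-balaban's scalar product -/

/-- **THE SOURCE PAIRING IS `Re ⟨toB5 h, toB5 ζ⟩`** (`P ≥ 1`). [folklore] -/
theorem srcPair_eq_re_dotProduct (P : ℕ) [NeZero P] (h ζ : Site d → Fin d → 𝕄₁) :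
    srcPair h ζ (periodBox (d := d) P) = (star (toB5 (N := fun _ : Fin d => P) h) ⬝ᵥ toB5 ζ).re := by
  rw [dotProduct, Fintype.sum_prod_type, Complex.re_sum, NE7FlatSliceSourceDuality.srcPair]
  rw [← sum_tor_liftT P (fun y => ∑ κ : Fin d, hsR (h y κ) (ζ y κ))]
  refine Finset.sum_congr rfl fun x _ => ?_
  rw [Complex.re_sum]
  refine Finset.sum_congr rfl fun κ _ => ?_
  rw [hsR_fin_one, Pi.star_apply, toB5_apply, toB5_apply, Complex.star_def]

end

end Summit.QuantumFields.BalabanUV.T4Continuum.NE7StraightSliceB5ChartForms
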